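import Summits.HodgeConjecture.HodgeConjecture.Theorems.Ring2HypothesesDescentAbsoluteExteriorStabilizerProducts
import Literature.AlgebraicGeometry.Milne1999.SpecialLefschetzGroupInvariantsProducts
import HarnessLib

/-!
# Ring 2 — hypotheses layer, descent axis: PRODUCTS — MILNE'S PROP. 1.5 TANNAKA-FREE: `S(B × C) = S(B) × S(C)` for `Hom`-orthogonal
# positive-dimensional complex abelian varieties (the bottom of the tower splits exactly when no homomorphism links the factors)

HONEST FRAMING (page 1, verbatim the cell's standing line): **research route conditional on HC_CM; not a corollary;
Q11.4-sentence-2 already refuted in dim ≥ 3.** Nothing in this file proves a case of the Hodge conjecture; nothing discharges the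
binder of record b06 `Ring2.Hypotheses.AbsoluteHodgeImpliesAlgebraicAV` (OPEN); the binder table's numbers do not move. `HC_CM`,
`HC_AV` and row b06 are ABSENT from this file. Hodge ladder STAGE 3, `BINDER-OWNERS.md` row **b06**, seat `ring2-b06` (gen 87). It
closes the item the companion `…ExteriorStabilizerProducts` lists under "NOT obtained": the EQUALITY `S(B × C) = S(B) × S(C)` for
`Hom`-orthogonal pairs, Tannaka-free. Source (held text `paper:doi-10-1215-s0012-7094-99-09620-5` = J. S. Milne, *Lefschetz classes on
abelian varieties*, Duke Math. J. 96 (1999), §1 p. 643 and Prop. 1.5 p. 644, as quoted in the Milne lane's `LefschetzGroupProducts` /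
`SpecialLefschetzGroupInvariantsProducts`): "Let `A = A_1 × ⋯ × A_s`. Then `C(A) ⊂ C(A_1) × ⋯ × C(A_s)`, with equality holding if and only if
`Hom(A_i, A_j) = 0` for all `i, j`, `i ≠ j`."; Prop. 1.5: "Any such isogeny induces an isomorphism `S(A_1) × ⋯ × S(A_s) → S(A)`".

* `prodBlockDiagEquiv_mem_specialLefschetzGroup_of_hom_eq_zero` — **`⊇`: for `Hom(B, C) = 0 = Hom(C, B)`, `0 < dim B`, `0 < dim C` and
  `g ∈ S(B)`, `k ∈ S(C)` (Milne's Tannaka-free special Lefschetz groups), `⋀•(g₁ ⊕ k₁) ∈ S(B × C)`.** Assembly of the Milne lane ON `H¹`: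
  polarization classes `h_B`, `h_C` exist (`exists_polarizationClass`: rational, Kähler multiple, in `B¹ ⊗ ℂ`, top power `≠ 0`, `Q_h`
  non-degenerate); `g₁ ∈ U(C(B) ⊗ ℂ, †_{h_B})` (`specialLefschetzGroup_map_one_le_unitaryCentralizerGroup`); `g₁ ⊕ k₁ ∈ U(C(B × C) ⊗ ℂ, †)` for
  the product polarization when `Hom = 0` (`prodBlockDiagEquiv_mem_unitaryCentralizerGroup`, Milne §1 p. 643 / Prop. 1.5); and
  `⋀•u ∈ S(B × C)` for every `u ∈ U(C(B × C) ⊗ ℂ, †)` (Thm. 4.4's `exteriorPullbackEquiv_mem_specialLefschetzGroup`, with the product class's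
  data `prodPolarizationClass_mem_hodgeClassSpan`, `lefschetzPow_prodPolarizationClass_self_ne_zero`,
  `eq_zero_of_forall_polarizationPairingOne_prod_eq_zero`).
* `mem_specialLefschetzGroup_prod_iff_of_hom_eq_zero` — **MILNE PROP. 1.5, BINARY CASE, TANNAKA-FREE: `S(B × C) = S(B) × S(C)`**:
  `g' ∈ S(B × C) ⟺ g' = ⋀•(g₁ ⊕ k₁)` with `g ∈ S(B)`, `k ∈ S(C)` (`⟸` above; `⟹` is the companion's hypothesis-free
  `S(B × C) ≤ S(B) × S(C)`); `H¹` form `mem_map_evalOne_specialLefschetzGroup_prod_iff_of_hom_eq_zero`.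

HONEST COLUMN. No definition, no named fact, no sorry; FACT-FREE (no fact of record displayed). As a SLICE nothing is new; new is the
GROUP statement for Milne's Tannaka-free `S` (the lane had it on `H¹`: `U(C(B × C)) = U(C(B)) × U(C(C))`, `LefschetzGroupProducts`). NOT
obtained: the converse «splitting ⟹ `Hom(B, C) = 0`» for `S` (the lane's `hom_eq_zero_of_restrictHom_surjective` is the `C(·)`-version;
the `S`-version would need `2 ∈ U`… — not pursued), `s ≥ 3` factors (iterate), `L(B × C) = L(B) ×_{𝔾_m} L(C)` Tannaka-free (the lane's
`LefschetzGroupProducts` on `H¹`), anything deciding the row. PRESEARCH: Milne 1999 §1 p. 643 / Prop. 1.5 (the lane's verbatim quotes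
re-read); certification by assembly, no novelty claimed. References (bib keys): Milne1999LefschetzClasses (§1 p. 643, Prop. 1.5, Thm. 4.4,
Cor. 4.5), MoonenZarhin1999LowDim (§3 (3.1)), VoisinHodgeI2002 (§3.1.3 Cor. 3.9, Thm. 6.25), LangeBirkenhake1992 (§5.3).
-/

noncomputable section

-- every declaration of this problem lives in `Summit.HodgeConjecture.HodgeConjecture.…` (summit = sub-problem)
set_option linter.dupNamespace false

namespace Summit.HodgeConjecture.HodgeConjecture.Ring2.Hypotheses

open CategoryTheory AlgebraicGeometry MonoidalCategory CartesianMonoidalCategory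
open Literature.AlgebraicGeometry Literature.AlgebraicGeometry.Motives
open Literature.AlgebraicGeometry.HodgeTheory
open Literature.AlgebraicTopology.SingularHomology
open Literature.AlgebraicGeometry.Milne1999 (specialLefschetzGroup unitaryCentralizerGroup exteriorPullbackEquiv prodBlockDiagEquiv
  prodPolarizationClass)

section Lefschetz

variable (B C : AbelianVariety ℂ)

/-- **`S(B) × S(C) ≤ S(B × C)` for `Hom`-orthogonal positive-dimensional factors, Tannaka-free** (Milne Prop. 1.5, binary case): for
`g ∈ S(B)`, `k ∈ S(C)`, `⋀•(g₁ ⊕ k₁) ∈ S(B × C)` — through `H¹`: `g₁ ∈ U(C(B) ⊗ ℂ, †)`, `k₁ ∈ U(C(C) ⊗ ℂ, †)`, `g₁ ⊕ k₁ ∈ U(C(B × C) ⊗ ℂ, †)`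
for the product polarization (`Hom = 0`), and Thm. 4.4. [cite: Milne1999LefschetzClasses, §1 p. 643, Prop. 1.5 (p. 644) and Thm. 4.4] -/
theorem prodBlockDiagEquiv_mem_specialLefschetzGroup_of_hom_eq_zero (hBC : ∀ f : B ⟶ C, f = 0) (hCB : ∀ f : C ⟶ B, f = 0)
    (hB0 : 0 < B.dim) (hC0 : 0 < C.dim)
    {g : ∀ i : ℕ, complexBetti B.X i ≃ₗ[ℂ] complexBetti B.X i} (hg : g ∈ specialLefschetzGroup B.dim B.X)
    {k : ∀ i : ℕ, complexBetti C.X i ≃ₗ[ℂ] complexBetti C.X i} (hk : k ∈ specialLefschetzGroup C.dim C.X) :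
    (fun i ↦ exteriorPullbackEquiv (AbelianVariety.hasExteriorCohomologyH1_complexPoints (B.prod C)) (prodBlockDiagEquiv (g 1) (k 1)) i) ∈
      specialLefschetzGroup (B.prod C).dim (B.prod C).X := by
  obtain ⟨hB, hQB, hKB, hhB, hBtop, hndB⟩ := Milne1999.exists_polarizationClass B hB0
  obtain ⟨hC, hQC, hKC, hhC, hCtop, hndC⟩ := Milne1999.exists_polarizationClass C hC0
  have hs : g 1 ∈ unitaryCentralizerGroup B hB :=
    Milne1999.specialLefschetzGroup_map_one_le_unitaryCentralizerGroup B hQB hKB (Subgroup.mem_map_of_mem _ hg)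
  have ht : k 1 ∈ unitaryCentralizerGroup C hC :=
    Milne1999.specialLefschetzGroup_map_one_le_unitaryCentralizerGroup C hQC hKC (Subgroup.mem_map_of_mem _ hk)
  have hu := Milne1999.prodBlockDiagEquiv_mem_unitaryCentralizerGroup hBC hCB hBtop hCtop hs ht
  have h0 : 0 < (B.prod C).dim := by rw [AbelianVariety.dim_prod]; exact Nat.add_pos_left hB0 _
  exact Milne1999.exteriorPullbackEquiv_mem_specialLefschetzGroup h0 (Milne1999.prodPolarizationClass_mem_hodgeClassSpan hB hC hhB hhC)
    (Milne1999.lefschetzPow_prodPolarizationClass_self_ne_zero hB hC hB0 hC0 hBtop hCtop)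
    (Milne1999.eq_zero_of_forall_polarizationPairingOne_prod_eq_zero hB hC hB0 hC0 hBtop hCtop hndB hndC) hu

/-- **MILNE 1999 PROP. 1.5, BINARY CASE, TANNAKA-FREE: `S(B × C) = S(B) × S(C)` for `Hom(B, C) = 0 = Hom(C, B)`, `0 < dim B`, `0 < dim C`.**
A family `g'` of automorphisms of the `Hᵏ((B × C)(ℂ); ℂ)` lies in the special Lefschetz group of `B × C` iff `g' = ⋀•(g₁ ⊕ k₁)` with
`g ∈ S(B)`, `k ∈ S(C)` ("Any such isogeny induces an isomorphism `S(A_1) × ⋯ × S(A_s) → S(A)`"; `⟹` holds for every pair, companion §4).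
[cite: Milne1999LefschetzClasses, Prop. 1.5 (p. 644) and §1 p. 643] -/
theorem mem_specialLefschetzGroup_prod_iff_of_hom_eq_zero (hBC : ∀ f : B ⟶ C, f = 0) (hCB : ∀ f : C ⟶ B, f = 0)
    (hB0 : 0 < B.dim) (hC0 : 0 < C.dim) (g' : ∀ i : ℕ, complexBetti (B.prod C).X i ≃ₗ[ℂ] complexBetti (B.prod C).X i) :
    g' ∈ specialLefschetzGroup (B.prod C).dim (B.prod C).X ↔
      ∃ g ∈ specialLefschetzGroup B.dim B.X, ∃ k ∈ specialLefschetzGroup C.dim C.X,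
        g' = fun i ↦ exteriorPullbackEquiv (AbelianVariety.hasExteriorCohomologyH1_complexPoints (B.prod C)) (prodBlockDiagEquiv (g 1) (k 1)) i := by
  constructor
  · intro hg'
    obtain ⟨u, v, hu, hv, e⟩ := exists_eq_prodBlockDiagEquiv_of_mem_specialLefschetzGroup_prod B C hg'
    refine ⟨_, hu, _, hv, ?_⟩
    rw [Milne1999.exteriorPullbackEquiv_one_eq, Milne1999.exteriorPullbackEquiv_one_eq]
    exact e
  · rintro ⟨g, hg, k, hk, rfl⟩
    exact prodBlockDiagEquiv_mem_specialLefschetzGroup_of_hom_eq_zero B C hBC hCB hB0 hC0 hg hk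

/-- **On `H¹`: `S(B × C)|_{H¹} = {s ⊕ t | s ∈ S(B)|_{H¹}, t ∈ S(C)|_{H¹}}`** for `Hom`-orthogonal positive-dimensional factors (the lane's
`U(C(B × C)) = U(C(B)) × U(C(C))` read through Thm. 4.4 on the three varieties). [cite: Milne1999LefschetzClasses, Prop. 1.5 (p. 644) and Thm. 4.4] -/
theorem mem_map_evalOne_specialLefschetzGroup_prod_iff_of_hom_eq_zero (hBC : ∀ f : B ⟶ C, f = 0) (hCB : ∀ f : C ⟶ B, f = 0)
    (hB0 : 0 < B.dim) (hC0 : 0 < C.dim) (U : complexBetti (B.prod C).X 1 ≃ₗ[ℂ] complexBetti (B.prod C).X 1) :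
    U ∈ (specialLefschetzGroup (B.prod C).dim (B.prod C).X).map
        (Pi.evalMonoidHom (fun i : ℕ ↦ complexBetti (B.prod C).X i ≃ₗ[ℂ] complexBetti (B.prod C).X i) 1) ↔
      ∃ s ∈ (specialLefschetzGroup B.dim B.X).map (Pi.evalMonoidHom (fun i : ℕ ↦ complexBetti B.X i ≃ₗ[ℂ] complexBetti B.X i) 1),
        ∃ t ∈ (specialLefschetzGroup C.dim C.X).map (Pi.evalMonoidHom (fun i : ℕ ↦ complexBetti C.X i ≃ₗ[ℂ] complexBetti C.X i) 1),
          U = prodBlockDiagEquiv s t := by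
  constructor
  · intro hU
    obtain ⟨g', hg', rfl⟩ := Subgroup.mem_map.1 hU
    obtain ⟨g, hg, k, hk, e⟩ := (mem_specialLefschetzGroup_prod_iff_of_hom_eq_zero B C hBC hCB hB0 hC0 g').1 hg'
    refine ⟨g 1, Subgroup.mem_map_of_mem _ hg, k 1, Subgroup.mem_map_of_mem _ hk, ?_⟩
    rw [Pi.evalMonoidHom_apply, e]
    exact Milne1999.exteriorPullbackEquiv_one_eq _ _
  · rintro ⟨s, hs, t, ht, rfl⟩
    obtain ⟨g, hg, rfl⟩ := Subgroup.mem_map.1 hs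
    obtain ⟨k, hk, rfl⟩ := Subgroup.mem_map.1 ht
    exact Subgroup.mem_map.2 ⟨_, prodBlockDiagEquiv_mem_specialLefschetzGroup_of_hom_eq_zero B C hBC hCB hB0 hC0 hg hk,
      Milne1999.exteriorPullbackEquiv_one_eq _ _⟩

end Lefschetz

end Summit.HodgeConjecture.HodgeConjecture.Ring2.Hypotheses

end
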